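import Mathlib
import HarnessLib

/-!
# Format C, design C∞: two-sided tails `Σ_{j≥0} log(B₃+j)/(B₃+j)^{k+1}` and `Σ_{j≥0} log²(B₃+j)/(B₃+j)^{k+1}`

Route context: Fourier–Galerkin / Schur-complement certificates of Weil positivity on a window ("format C", design C∞;
cell memo `run/shared/lean/pub/rh-explicit/rh-explicit-weil-2/gen9/CINF-DOOR-SIZING.md` §3/§6; supporting
stmt-RiemannHypothesis-0098; seat rh-explicit-weil-2, (E) side of the C∞ door of rh-explicit-weil-10).

The coupling tail of a C∞ rung is a Gram over `{m^{−e}, m^{−e} log m} ⊗ {1, cos(mθ_p), sin(mθ_p)}` (the Re ψ factor of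
the profile images grows like `½ log m`); besides the zeta tails of `WeilFormatCZetaTailGram` the (E) side needs the LOG tails,
two-sided.  With `k = e − 1 ≥ 1`, `F_k(x) = (log x/k + 1/k²)/x^k` (`F_k′ = −log x/x^{k+1}`),
`G_k(x) = (log²x/k + 2 log x/k² + 2/k³)/x^k` (`G_k′ = −log²x/x^{k+1}`) and the mean value theorem on `[m, m+1]`:
`summable_log_div_add_pow` / `le_tsum_log_div_add_pow`: `F_k(B₃) ≤ Σ_{j≥0} log(B₃+j)/(B₃+j)^{k+1} ≤ F_k(B₃−1)` (`3 ≤ B₃`);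
`summable_logSq_div_add_pow` / `le_tsum_logSq_div_add_pow`: `G_k(B₃) ≤ Σ_{j≥0} log²(B₃+j)/(B₃+j)^{k+1} ≤ G_k(B₃−1)` (`4 ≤ B₃`);
with the lemmas `hasDerivAt_log(Sq)TailPrim`, `log(Sq)_div_pow_antitoneOn`, `log(Sq)_div_pow_telescope` on the way.
Elementary calculus; standard axioms; no definitions; no RH claim.
-/

-- `Summit.RiemannHypothesis.RiemannHypothesis.…` is the layout-mandated namespace (summit = problem name).
set_option linter.dupNamespace false

noncomputable section

open Real Filter Set
open scoped Topology

namespace Summit.RiemannHypothesis.RiemannHypothesis.Theorems.WeilFormatC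

/-! ## The antiderivatives -/

section Prim

/-- `d/dx [(log x/k + 1/k²)/x^k] = −log x/x^{k+1}` for `x > 0`, `1 ≤ k`. -/
theorem hasDerivAt_logTailPrim {k : ℕ} (hk : 1 ≤ k) {x : ℝ} (hx : 0 < x) :
    HasDerivAt (fun y : ℝ ↦ (Real.log y / k + 1 / (k : ℝ) ^ 2) / y ^ k) (-(Real.log x / x ^ (k + 1))) x := by
  have hk0 : (k : ℝ) ≠ 0 := by have : (1 : ℝ) ≤ k := (by exact_mod_cast hk); linarith
  have hxne : x ≠ 0 := hx.ne'
  have hnum : HasDerivAt (fun y : ℝ ↦ Real.log y / k + 1 / (k : ℝ) ^ 2) (x⁻¹ / k) x := by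
    simpa using ((Real.hasDerivAt_log hxne).div_const (k : ℝ)).add_const (1 / (k : ℝ) ^ 2)
  have hden : HasDerivAt (fun y : ℝ ↦ y ^ k) ((k : ℝ) * x ^ (k - 1)) x := by
    simpa using hasDerivAt_pow k x
  have h := hnum.fun_div hden (pow_ne_zero _ hxne)
  refine h.congr_deriv ?_
  obtain ⟨j, rfl⟩ : ∃ j : ℕ, k = j + 1 := ⟨k - 1, by omega⟩
  simp only [Nat.add_sub_cancel]
  push_cast
  have hj : (j : ℝ) + 1 ≠ 0 := by positivity
  field_simp
  ring

/-- `d/dx [(log²x/k + 2 log x/k² + 2/k³)/x^k] = −log²x/x^{k+1}` for `x > 0`, `1 ≤ k`. -/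
theorem hasDerivAt_logSqTailPrim {k : ℕ} (hk : 1 ≤ k) {x : ℝ} (hx : 0 < x) :
    HasDerivAt (fun y : ℝ ↦ (Real.log y ^ 2 / k + 2 * Real.log y / (k : ℝ) ^ 2 + 2 / (k : ℝ) ^ 3) / y ^ k)
      (-(Real.log x ^ 2 / x ^ (k + 1))) x := by
  have hk0 : (k : ℝ) ≠ 0 := by have : (1 : ℝ) ≤ k := (by exact_mod_cast hk); linarith
  have hxne : x ≠ 0 := hx.ne'
  have hlog := Real.hasDerivAt_log hxne
  have h1 : HasDerivAt (fun y : ℝ ↦ Real.log y ^ 2) ((2 : ℕ) * Real.log x ^ (2 - 1) * x⁻¹) x := hlog.fun_pow 2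
  have h2 : HasDerivAt (fun y : ℝ ↦ 2 * Real.log y) (2 * x⁻¹) x := hlog.const_mul 2
  have hnum : HasDerivAt (fun y : ℝ ↦ Real.log y ^ 2 / k + 2 * Real.log y / (k : ℝ) ^ 2 + 2 / (k : ℝ) ^ 3)
      ((2 : ℕ) * Real.log x ^ (2 - 1) * x⁻¹ / k + 2 * x⁻¹ / (k : ℝ) ^ 2) x := by
    simpa using ((h1.div_const (k : ℝ)).add (h2.div_const ((k : ℝ) ^ 2))).add_const (2 / (k : ℝ) ^ 3)
  have hden : HasDerivAt (fun y : ℝ ↦ y ^ k) ((k : ℝ) * x ^ (k - 1)) x := by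
    simpa using hasDerivAt_pow k x
  have h := hnum.fun_div hden (pow_ne_zero _ hxne)
  refine h.congr_deriv ?_
  obtain ⟨j, rfl⟩ : ∃ j : ℕ, k = j + 1 := ⟨k - 1, by omega⟩
  simp only [Nat.add_sub_cancel]
  push_cast
  have hj : (j : ℝ) + 1 ≠ 0 := by positivity
  field_simp
  ring

end Prim

/-! ## Monotonicity of the summands -/

section Mono

/-- `log x / x^{k+1}` is antitone on `[2, ∞)` for `1 ≤ k` (there `(k+1) log x ≥ 2 log 2 > 1`). -/
theorem log_div_pow_antitoneOn {k : ℕ} (hk : 1 ≤ k) :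
    AntitoneOn (fun x : ℝ ↦ Real.log x / x ^ (k + 1)) (Ici 2) := by
  have hlog2 : (1 : ℝ) / 2 < Real.log 2 := by have := Real.log_two_gt_d9; linarith
  refine antitoneOn_of_deriv_nonpos (convex_Ici 2) ?_ ?_ ?_
  · refine ContinuousOn.div ?_ (continuous_pow (k + 1)).continuousOn ?_
    · exact Real.continuousOn_log.mono fun x hx ↦ by
        simp only [mem_Ici] at hx; exact ne_of_gt (by linarith)
    · intro x hx; simp only [mem_Ici] at hx; positivity
  · intro x hx
    rw [interior_Ici, mem_Ioi] at hx
    have hx0 : x ≠ 0 := by linarith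
    exact ((Real.differentiableAt_log hx0).div (differentiableAt_pow _) (pow_ne_zero _ hx0)).differentiableWithinAt
  · intro x hx
    rw [interior_Ici, mem_Ioi] at hx
    have hx0 : 0 < x := by linarith
    have hd : HasDerivAt (fun y : ℝ ↦ Real.log y / y ^ (k + 1))
        ((x⁻¹ * x ^ (k + 1) - Real.log x * (((k + 1 : ℕ) : ℝ) * x ^ (k + 1 - 1))) / (x ^ (k + 1)) ^ 2) x :=
      (Real.hasDerivAt_log hx0.ne').fun_div (by simpa using hasDerivAt_pow (k + 1) x) (pow_ne_zero _ hx0.ne')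
    rw [hd.deriv]
    apply div_nonpos_of_nonpos_of_nonneg _ (by positivity)
    simp only [Nat.add_sub_cancel]
    have hlx : Real.log 2 ≤ Real.log x := Real.log_le_log (by norm_num) hx.le
    have hk1 : (1 : ℝ) ≤ k := by exact_mod_cast hk
    have hxk : 0 < x ^ k := pow_pos hx0 k
    rw [show x⁻¹ * x ^ (k + 1) = x ^ k by rw [pow_succ]; field_simp]
    push_cast
    -- x^k (1 − (k+1) log x) ≤ 0
    have hneg : 1 - ((k : ℝ) + 1) * Real.log x ≤ 0 := by nlinarith
    have : x ^ k - Real.log x * (((k : ℝ) + 1) * x ^ k) = x ^ k * (1 - ((k : ℝ) + 1) * Real.log x) := by ring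
    rw [this]
    exact mul_nonpos_of_nonneg_of_nonpos hxk.le hneg

/-- `log² x / x^{k+1}` is antitone on `[3, ∞)` for `1 ≤ k` (there `(k+1) log x ≥ 2 log 3 > 2`). -/
theorem logSq_div_pow_antitoneOn {k : ℕ} (hk : 1 ≤ k) :
    AntitoneOn (fun x : ℝ ↦ Real.log x ^ 2 / x ^ (k + 1)) (Ici 3) := by
  have hlog3 : (1 : ℝ) < Real.log 3 := by
    rw [← Real.exp_lt_exp, Real.exp_log (by norm_num : (0:ℝ) < 3)]; have := Real.exp_one_lt_d9; linarith
  refine antitoneOn_of_deriv_nonpos (convex_Ici 3) ?_ ?_ ?_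
  · refine ContinuousOn.div ?_ (continuous_pow (k + 1)).continuousOn ?_
    · exact (Real.continuousOn_log.mono fun x hx ↦ by
        simp only [mem_Ici] at hx; exact ne_of_gt (by linarith)).pow 2
    · intro x hx; simp only [mem_Ici] at hx; positivity
  · intro x hx
    rw [interior_Ici, mem_Ioi] at hx
    have hx0 : x ≠ 0 := by linarith
    exact (((Real.differentiableAt_log hx0).pow 2).div (differentiableAt_pow _)
      (pow_ne_zero _ hx0)).differentiableWithinAt
  · intro x hx
    rw [interior_Ici, mem_Ioi] at hx
    have hx0 : 0 < x := by linarith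
    have h1 : HasDerivAt (fun y : ℝ ↦ Real.log y ^ 2) ((2 : ℕ) * Real.log x ^ (2 - 1) * x⁻¹) x :=
      (Real.hasDerivAt_log hx0.ne').fun_pow 2
    have hd : HasDerivAt (fun y : ℝ ↦ Real.log y ^ 2 / y ^ (k + 1))
        (((2 : ℕ) * Real.log x ^ (2 - 1) * x⁻¹ * x ^ (k + 1)
          - Real.log x ^ 2 * (((k + 1 : ℕ) : ℝ) * x ^ (k + 1 - 1))) / (x ^ (k + 1)) ^ 2) x :=
      h1.fun_div (by simpa using hasDerivAt_pow (k + 1) x) (pow_ne_zero _ hx0.ne')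
    rw [hd.deriv]
    apply div_nonpos_of_nonpos_of_nonneg _ (by positivity)
    simp only [Nat.add_sub_cancel, show (2 : ℕ) - 1 = 1 from rfl, pow_one]
    have hlx : Real.log 3 ≤ Real.log x := Real.log_le_log (by norm_num) hx.le
    have hlpos : 0 < Real.log x := by linarith
    have hk1 : (1 : ℝ) ≤ k := by exact_mod_cast hk
    have hxk : 0 < x ^ k := pow_pos hx0 k
    rw [show ((2 : ℕ) : ℝ) * Real.log x * x⁻¹ * x ^ (k + 1) = 2 * Real.log x * x ^ k by
      push_cast; rw [pow_succ]; field_simp]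
    push_cast
    have hneg : 2 - ((k : ℝ) + 1) * Real.log x ≤ 0 := by nlinarith
    have : 2 * Real.log x * x ^ k - Real.log x ^ 2 * (((k : ℝ) + 1) * x ^ k)
        = (Real.log x * x ^ k) * (2 - ((k : ℝ) + 1) * Real.log x) := by ring
    rw [this]
    exact mul_nonpos_of_nonneg_of_nonpos (mul_pos hlpos hxk).le hneg

end Mono

/-! ## The MVT sandwich on `[m, m+1]` -/

section Telescope

/-- For `1 ≤ k`, `2 ≤ m`: `log(m+1)/(m+1)^{k+1} ≤ F_k(m) − F_k(m+1) ≤ log m/m^{k+1}`, `F_k(x) = (log x/k + 1/k²)/x^k`. -/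
theorem log_div_pow_telescope {k : ℕ} (hk : 1 ≤ k) {m : ℝ} (hm : 2 ≤ m) :
    Real.log (m + 1) / (m + 1) ^ (k + 1)
        ≤ (Real.log m / k + 1 / (k : ℝ) ^ 2) / m ^ k - (Real.log (m + 1) / k + 1 / (k : ℝ) ^ 2) / (m + 1) ^ k
      ∧ (Real.log m / k + 1 / (k : ℝ) ^ 2) / m ^ k - (Real.log (m + 1) / k + 1 / (k : ℝ) ^ 2) / (m + 1) ^ k
        ≤ Real.log m / m ^ (k + 1) := by
  set F : ℝ → ℝ := fun y ↦ (Real.log y / k + 1 / (k : ℝ) ^ 2) / y ^ k with hF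
  have hcont : ContinuousOn F (Icc m (m + 1)) := fun y hy ↦
    (hasDerivAt_logTailPrim hk (by linarith [hy.1] : 0 < y)).continuousAt.continuousWithinAt
  have hderiv : ∀ y ∈ Ioo m (m + 1), HasDerivAt F (-(Real.log y / y ^ (k + 1))) y := fun y hy ↦
    hasDerivAt_logTailPrim hk (by linarith [hy.1])
  obtain ⟨c, hc, hcd⟩ := exists_hasDerivAt_eq_slope F (fun y ↦ -(Real.log y / y ^ (k + 1))) (by linarith) hcont hderiv
  have hslope : F m - F (m + 1) = Real.log c / c ^ (k + 1) := by
    have : (-(Real.log c / c ^ (k + 1))) * (m + 1 - m) = F (m + 1) - F m := by rw [hcd]; field_simp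
    linarith
  have hanti := log_div_pow_antitoneOn hk
  have hc2 : c ∈ Ici (2 : ℝ) := le_trans hm hc.1.le
  have hm12 : m + 1 ∈ Ici (2 : ℝ) := by simp only [mem_Ici]; linarith
  change Real.log (m + 1) / (m + 1) ^ (k + 1) ≤ F m - F (m + 1) ∧ F m - F (m + 1) ≤ Real.log m / m ^ (k + 1)
  rw [hslope]
  exact ⟨hanti hc2 hm12 hc.2.le, hanti (show m ∈ Ici (2 : ℝ) from hm) hc2 hc.1.le⟩

/-- For `1 ≤ k`, `3 ≤ m`: `log²(m+1)/(m+1)^{k+1} ≤ G_k(m) − G_k(m+1) ≤ log²m/m^{k+1}`,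
`G_k(x) = (log²x/k + 2 log x/k² + 2/k³)/x^k`. -/
theorem logSq_div_pow_telescope {k : ℕ} (hk : 1 ≤ k) {m : ℝ} (hm : 3 ≤ m) :
    Real.log (m + 1) ^ 2 / (m + 1) ^ (k + 1)
        ≤ (Real.log m ^ 2 / k + 2 * Real.log m / (k : ℝ) ^ 2 + 2 / (k : ℝ) ^ 3) / m ^ k
          - (Real.log (m + 1) ^ 2 / k + 2 * Real.log (m + 1) / (k : ℝ) ^ 2 + 2 / (k : ℝ) ^ 3) / (m + 1) ^ k
      ∧ (Real.log m ^ 2 / k + 2 * Real.log m / (k : ℝ) ^ 2 + 2 / (k : ℝ) ^ 3) / m ^ k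
          - (Real.log (m + 1) ^ 2 / k + 2 * Real.log (m + 1) / (k : ℝ) ^ 2 + 2 / (k : ℝ) ^ 3) / (m + 1) ^ k
        ≤ Real.log m ^ 2 / m ^ (k + 1) := by
  set G : ℝ → ℝ := fun y ↦ (Real.log y ^ 2 / k + 2 * Real.log y / (k : ℝ) ^ 2 + 2 / (k : ℝ) ^ 3) / y ^ k with hG
  have hcont : ContinuousOn G (Icc m (m + 1)) := fun y hy ↦
    (hasDerivAt_logSqTailPrim hk (by linarith [hy.1] : 0 < y)).continuousAt.continuousWithinAt
  have hderiv : ∀ y ∈ Ioo m (m + 1), HasDerivAt G (-(Real.log y ^ 2 / y ^ (k + 1))) y := fun y hy ↦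
    hasDerivAt_logSqTailPrim hk (by linarith [hy.1])
  obtain ⟨c, hc, hcd⟩ :=
    exists_hasDerivAt_eq_slope G (fun y ↦ -(Real.log y ^ 2 / y ^ (k + 1))) (by linarith) hcont hderiv
  have hslope : G m - G (m + 1) = Real.log c ^ 2 / c ^ (k + 1) := by
    have : (-(Real.log c ^ 2 / c ^ (k + 1))) * (m + 1 - m) = G (m + 1) - G m := by rw [hcd]; field_simp
    linarith
  have hanti := logSq_div_pow_antitoneOn hk
  have hc3 : c ∈ Ici (3 : ℝ) := le_trans hm hc.1.le
  have hm13 : m + 1 ∈ Ici (3 : ℝ) := by simp only [mem_Ici]; linarith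
  change Real.log (m + 1) ^ 2 / (m + 1) ^ (k + 1) ≤ G m - G (m + 1) ∧ G m - G (m + 1) ≤ Real.log m ^ 2 / m ^ (k + 1)
  rw [hslope]
  exact ⟨hanti hc3 hm13 hc.2.le, hanti (show m ∈ Ici (3 : ℝ) from hm) hc3 hc.1.le⟩

end Telescope

/-! ## Two-sided tails -/

section Tails

/-- A nonnegative sequence dominated termwise by a telescoping difference of a nonnegative function is summable and its
sum lies below the first telescoping value. -/
theorem summable_and_tsum_le_of_telescope {t P : ℕ → ℝ} (ht : ∀ j, 0 ≤ t j) (hP : ∀ j, 0 ≤ P j)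
    (htel : ∀ j, t j ≤ P j - P (j + 1)) :
    Summable t ∧ ∑' j, t j ≤ P 0 := by
  have hpartial : ∀ n, ∑ j ∈ Finset.range n, t j ≤ P 0 := by
    intro n
    calc ∑ j ∈ Finset.range n, t j ≤ ∑ j ∈ Finset.range n, (P j - P (j + 1)) :=
          Finset.sum_le_sum fun j _ ↦ htel j
      _ = P 0 - P n := Finset.sum_range_sub' P n
      _ ≤ P 0 := by linarith [hP n]
  exact ⟨summable_of_sum_range_le ht hpartial, Real.tsum_le_of_sum_range_le ht hpartial⟩

/-- The lower telescoping bound: if `P j − P (j+1) ≤ t j`, `t` summable and `P n → 0`, then `P 0 ≤ Σ' t`. -/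
theorem le_tsum_of_telescope {t P : ℕ → ℝ} (hs : Summable t) (hP0 : Tendsto P atTop (𝓝 0))
    (htel : ∀ j, P j - P (j + 1) ≤ t j) :
    P 0 ≤ ∑' j, t j := by
  have hpartial : ∀ n, P 0 - P n ≤ ∑ j ∈ Finset.range n, t j := by
    intro n
    calc P 0 - P n = ∑ j ∈ Finset.range n, (P j - P (j + 1)) := (Finset.sum_range_sub' P n).symm
      _ ≤ _ := Finset.sum_le_sum fun j _ ↦ htel j
  have hg : Tendsto (fun n ↦ P 0 - P n) atTop (𝓝 (P 0 - 0)) := tendsto_const_nhds.sub hP0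
  have := le_of_tendsto_of_tendsto' hg hs.tendsto_sum_tsum_nat hpartial
  simpa using this

/-- `log^i x / x^k → 0` along `x = B₃ + n` (`k ≥ 1`, any `i`). -/
theorem tendsto_log_div_pow_add {k : ℕ} (hk : 1 ≤ k) (B₃ : ℕ) (i : ℕ) :
    Tendsto (fun n : ℕ ↦ Real.log ((B₃ : ℝ) + n) ^ i / ((B₃ : ℝ) + n) ^ k) atTop (𝓝 0) := by
  have hx : Tendsto (fun n : ℕ ↦ (B₃ : ℝ) + n) atTop atTop :=
    tendsto_atTop_add_const_left _ _ tendsto_natCast_atTop_atTop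
  -- log^i x / x → 0, and 0 ≤ log^i x / x^k ≤ log^i x / x for x ≥ 1
  have h0 : Tendsto (fun x : ℝ ↦ Real.log x ^ i / (1 * x + 0)) atTop (𝓝 0) :=
    Real.tendsto_pow_log_div_mul_add_atTop 1 0 i one_ne_zero
  have h0' : Tendsto (fun x : ℝ ↦ Real.log x ^ i / x) atTop (𝓝 0) := h0.congr fun x ↦ by simp
  have hup := h0'.comp hx
  have hlow : Tendsto (fun _ : ℕ ↦ (0 : ℝ)) atTop (𝓝 0) := tendsto_const_nhds
  refine tendsto_of_tendsto_of_tendsto_of_le_of_le' hlow hup ?_ ?_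
  · filter_upwards [Filter.eventually_ge_atTop 1] with n hn
    have : (1 : ℝ) ≤ (B₃ : ℝ) + n := by
      have : (1 : ℝ) ≤ n := (by exact_mod_cast hn); linarith [(Nat.cast_nonneg B₃ : (0 : ℝ) ≤ B₃)]
    exact div_nonneg (pow_nonneg (Real.log_nonneg this) _) (by positivity)
  · filter_upwards [Filter.eventually_ge_atTop 1] with n hn
    have h1 : (1 : ℝ) ≤ (B₃ : ℝ) + n := by
      have : (1 : ℝ) ≤ n := (by exact_mod_cast hn); linarith [(Nat.cast_nonneg B₃ : (0 : ℝ) ≤ B₃)]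
    simp only [Function.comp]
    have hnum : 0 ≤ Real.log ((B₃ : ℝ) + n) ^ i := pow_nonneg (Real.log_nonneg h1) _
    have hden : (B₃ : ℝ) + n ≤ ((B₃ : ℝ) + n) ^ k := by
      calc (B₃ : ℝ) + n = ((B₃ : ℝ) + n) ^ 1 := (pow_one _).symm
        _ ≤ ((B₃ : ℝ) + n) ^ k := pow_le_pow_right₀ h1 hk
    exact div_le_div_of_nonneg_left hnum (by linarith) hden

/-- `F_k(B₃ + n) → 0`. -/
theorem tendsto_logTailPrim_add {k : ℕ} (hk : 1 ≤ k) (B₃ : ℕ) :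
    Tendsto (fun n : ℕ ↦ (Real.log ((B₃ : ℝ) + n) / k + 1 / (k : ℝ) ^ 2) / ((B₃ : ℝ) + n) ^ k) atTop (𝓝 0) := by
  have h1 := tendsto_log_div_pow_add hk B₃ 1
  have hx : Tendsto (fun n : ℕ ↦ (B₃ : ℝ) + n) atTop atTop :=
    tendsto_atTop_add_const_left _ _ tendsto_natCast_atTop_atTop
  have hinv : Tendsto (fun n : ℕ ↦ 1 / ((B₃ : ℝ) + n) ^ k) atTop (𝓝 0) := by
    have := ((tendsto_pow_atTop (by omega : k ≠ 0)).comp hx).inv_tendsto_atTop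
    refine this.congr fun n ↦ ?_
    simp [one_div, Function.comp]
  have h := (h1.div_const (k : ℝ)).add (hinv.const_mul (1 / (k : ℝ) ^ 2))
  simp only [zero_div, mul_zero, add_zero] at h
  refine h.congr fun n ↦ ?_
  simp only [pow_one]
  ring

/-- `G_k(B₃ + n) → 0`. -/
theorem tendsto_logSqTailPrim_add {k : ℕ} (hk : 1 ≤ k) (B₃ : ℕ) :
    Tendsto (fun n : ℕ ↦ (Real.log ((B₃ : ℝ) + n) ^ 2 / k + 2 * Real.log ((B₃ : ℝ) + n) / (k : ℝ) ^ 2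
        + 2 / (k : ℝ) ^ 3) / ((B₃ : ℝ) + n) ^ k) atTop (𝓝 0) := by
  have h2 := tendsto_log_div_pow_add hk B₃ 2
  have h1 := tendsto_log_div_pow_add hk B₃ 1
  have hx : Tendsto (fun n : ℕ ↦ (B₃ : ℝ) + n) atTop atTop :=
    tendsto_atTop_add_const_left _ _ tendsto_natCast_atTop_atTop
  have hinv : Tendsto (fun n : ℕ ↦ 1 / ((B₃ : ℝ) + n) ^ k) atTop (𝓝 0) := by
    have := ((tendsto_pow_atTop (by omega : k ≠ 0)).comp hx).inv_tendsto_atTop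
    refine this.congr fun n ↦ ?_
    simp [one_div, Function.comp]
  have h := ((h2.div_const (k : ℝ)).add ((h1.const_mul 2).div_const ((k : ℝ) ^ 2))).add
    (hinv.const_mul (2 / (k : ℝ) ^ 3))
  simp only [zero_div, mul_zero, add_zero] at h
  refine h.congr fun n ↦ ?_
  simp only [pow_one]
  ring

/-- **Summability and upper bound**: for `1 ≤ k`, `3 ≤ B₃`,
`Σ_{j≥0} log(B₃+j)/(B₃+j)^{k+1} ≤ F_k(B₃−1) = (log(B₃−1)/k + 1/k²)/(B₃−1)^k`. -/
theorem summable_log_div_add_pow {k : ℕ} (hk : 1 ≤ k) {B₃ : ℕ} (hB₃ : 3 ≤ B₃) :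
    Summable (fun j : ℕ ↦ Real.log ((B₃ : ℝ) + j) / ((B₃ : ℝ) + j) ^ (k + 1))
      ∧ ∑' j : ℕ, Real.log ((B₃ : ℝ) + j) / ((B₃ : ℝ) + j) ^ (k + 1)
        ≤ (Real.log ((B₃ : ℝ) - 1) / k + 1 / (k : ℝ) ^ 2) / ((B₃ : ℝ) - 1) ^ k := by
  have hB : (3 : ℝ) ≤ B₃ := by exact_mod_cast hB₃
  set P : ℕ → ℝ := fun j ↦ (Real.log ((B₃ : ℝ) - 1 + j) / k + 1 / (k : ℝ) ^ 2) / ((B₃ : ℝ) - 1 + j) ^ k with hP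
  have ht : ∀ j : ℕ, 0 ≤ Real.log ((B₃ : ℝ) + j) / ((B₃ : ℝ) + j) ^ (k + 1) := fun j ↦ by
    have : (1 : ℝ) ≤ (B₃ : ℝ) + j := by linarith [(Nat.cast_nonneg j : (0:ℝ) ≤ j)]
    exact div_nonneg (Real.log_nonneg this) (by positivity)
  have hPnn : ∀ j : ℕ, 0 ≤ P j := fun j ↦ by
    have : (1 : ℝ) ≤ (B₃ : ℝ) - 1 + j := by linarith [(Nat.cast_nonneg j : (0:ℝ) ≤ j)]
    have := Real.log_nonneg this
    positivity
  have htel : ∀ j : ℕ, Real.log ((B₃ : ℝ) + j) / ((B₃ : ℝ) + j) ^ (k + 1) ≤ P j - P (j + 1) := by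
    intro j
    have hm : (2 : ℝ) ≤ (B₃ : ℝ) - 1 + j := by linarith [(Nat.cast_nonneg j : (0:ℝ) ≤ j)]
    have h := (log_div_pow_telescope hk hm).1
    rw [show (B₃ : ℝ) - 1 + j + 1 = (B₃ : ℝ) + j by ring] at h
    simp only [hP]
    push_cast
    rw [show (B₃ : ℝ) - 1 + (j + 1) = (B₃ : ℝ) + j by ring]
    exact h
  obtain ⟨hs, hle⟩ := summable_and_tsum_le_of_telescope ht hPnn htel
  refine ⟨hs, ?_⟩
  simpa [hP] using hle

/-- **Lower bound**: for `1 ≤ k`, `3 ≤ B₃`, `F_k(B₃) ≤ Σ_{j≥0} log(B₃+j)/(B₃+j)^{k+1}`. -/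
theorem le_tsum_log_div_add_pow {k : ℕ} (hk : 1 ≤ k) {B₃ : ℕ} (hB₃ : 3 ≤ B₃) :
    (Real.log (B₃ : ℝ) / k + 1 / (k : ℝ) ^ 2) / (B₃ : ℝ) ^ k
      ≤ ∑' j : ℕ, Real.log ((B₃ : ℝ) + j) / ((B₃ : ℝ) + j) ^ (k + 1) := by
  have hB : (3 : ℝ) ≤ B₃ := by exact_mod_cast hB₃
  obtain ⟨hs, -⟩ := summable_log_div_add_pow hk hB₃
  set P : ℕ → ℝ := fun j ↦ (Real.log ((B₃ : ℝ) + j) / k + 1 / (k : ℝ) ^ 2) / ((B₃ : ℝ) + j) ^ k with hP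
  have htel : ∀ j : ℕ, P j - P (j + 1) ≤ Real.log ((B₃ : ℝ) + j) / ((B₃ : ℝ) + j) ^ (k + 1) := by
    intro j
    have hm : (2 : ℝ) ≤ (B₃ : ℝ) + j := by linarith [(Nat.cast_nonneg j : (0:ℝ) ≤ j)]
    have h := (log_div_pow_telescope hk hm).2
    simp only [hP]
    push_cast
    rw [show (B₃ : ℝ) + (j + 1) = (B₃ : ℝ) + j + 1 by ring]
    exact h
  have := le_tsum_of_telescope hs (tendsto_logTailPrim_add hk B₃) htel
  simpa [hP] using this

/-- **Summability and upper bound (log²)**: for `1 ≤ k`, `4 ≤ B₃`, `Σ_{j≥0} log²(B₃+j)/(B₃+j)^{k+1} ≤ G_k(B₃−1)`. -/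
theorem summable_logSq_div_add_pow {k : ℕ} (hk : 1 ≤ k) {B₃ : ℕ} (hB₃ : 4 ≤ B₃) :
    Summable (fun j : ℕ ↦ Real.log ((B₃ : ℝ) + j) ^ 2 / ((B₃ : ℝ) + j) ^ (k + 1))
      ∧ ∑' j : ℕ, Real.log ((B₃ : ℝ) + j) ^ 2 / ((B₃ : ℝ) + j) ^ (k + 1)
        ≤ (Real.log ((B₃ : ℝ) - 1) ^ 2 / k + 2 * Real.log ((B₃ : ℝ) - 1) / (k : ℝ) ^ 2 + 2 / (k : ℝ) ^ 3) /
            ((B₃ : ℝ) - 1) ^ k := by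
  have hB : (4 : ℝ) ≤ B₃ := by exact_mod_cast hB₃
  set P : ℕ → ℝ := fun j ↦ (Real.log ((B₃ : ℝ) - 1 + j) ^ 2 / k + 2 * Real.log ((B₃ : ℝ) - 1 + j) / (k : ℝ) ^ 2
      + 2 / (k : ℝ) ^ 3) / ((B₃ : ℝ) - 1 + j) ^ k with hP
  have ht : ∀ j : ℕ, 0 ≤ Real.log ((B₃ : ℝ) + j) ^ 2 / ((B₃ : ℝ) + j) ^ (k + 1) := fun j ↦ by positivity
  have hPnn : ∀ j : ℕ, 0 ≤ P j := fun j ↦ by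
    have : (1 : ℝ) ≤ (B₃ : ℝ) - 1 + j := by linarith [(Nat.cast_nonneg j : (0:ℝ) ≤ j)]
    have := Real.log_nonneg this
    positivity
  have htel : ∀ j : ℕ, Real.log ((B₃ : ℝ) + j) ^ 2 / ((B₃ : ℝ) + j) ^ (k + 1) ≤ P j - P (j + 1) := by
    intro j
    have hm : (3 : ℝ) ≤ (B₃ : ℝ) - 1 + j := by linarith [(Nat.cast_nonneg j : (0:ℝ) ≤ j)]
    have h := (logSq_div_pow_telescope hk hm).1
    rw [show (B₃ : ℝ) - 1 + j + 1 = (B₃ : ℝ) + j by ring] at h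
    simp only [hP]
    push_cast
    rw [show (B₃ : ℝ) - 1 + (j + 1) = (B₃ : ℝ) + j by ring]
    exact h
  obtain ⟨hs, hle⟩ := summable_and_tsum_le_of_telescope ht hPnn htel
  refine ⟨hs, ?_⟩
  simpa [hP] using hle

/-- **Lower bound (log²)**: for `1 ≤ k`, `4 ≤ B₃`, `G_k(B₃) ≤ Σ_{j≥0} log²(B₃+j)/(B₃+j)^{k+1}`. -/
theorem le_tsum_logSq_div_add_pow {k : ℕ} (hk : 1 ≤ k) {B₃ : ℕ} (hB₃ : 4 ≤ B₃) :
    (Real.log (B₃ : ℝ) ^ 2 / k + 2 * Real.log (B₃ : ℝ) / (k : ℝ) ^ 2 + 2 / (k : ℝ) ^ 3) / (B₃ : ℝ) ^ k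
      ≤ ∑' j : ℕ, Real.log ((B₃ : ℝ) + j) ^ 2 / ((B₃ : ℝ) + j) ^ (k + 1) := by
  have hB : (4 : ℝ) ≤ B₃ := by exact_mod_cast hB₃
  obtain ⟨hs, -⟩ := summable_logSq_div_add_pow hk hB₃
  set P : ℕ → ℝ := fun j ↦ (Real.log ((B₃ : ℝ) + j) ^ 2 / k + 2 * Real.log ((B₃ : ℝ) + j) / (k : ℝ) ^ 2
      + 2 / (k : ℝ) ^ 3) / ((B₃ : ℝ) + j) ^ k with hP
  have htel : ∀ j : ℕ, P j - P (j + 1) ≤ Real.log ((B₃ : ℝ) + j) ^ 2 / ((B₃ : ℝ) + j) ^ (k + 1) := by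
    intro j
    have hm : (3 : ℝ) ≤ (B₃ : ℝ) + j := by linarith [(Nat.cast_nonneg j : (0:ℝ) ≤ j)]
    have h := (logSq_div_pow_telescope hk hm).2
    simp only [hP]
    push_cast
    rw [show (B₃ : ℝ) + (j + 1) = (B₃ : ℝ) + j + 1 by ring]
    exact h
  have := le_tsum_of_telescope hs (tendsto_logSqTailPrim_add hk B₃) htel
  simpa [hP] using this

end Tails

end Summit.RiemannHypothesis.RiemannHypothesis.Theorems.WeilFormatC

end
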